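/-
Copyright (c) 2026 the pub-hodgecm-mathlib formalisation cell (harness21).  R90-TF SLAB, section S10 (Rogawski 1990, Ch. 13.5–13.8 comparison engine read at `v`),
prover R90-C138-p03 (g0) — PAYER of socket A2c `sock_S10_frozenVectors` (road (β-FL), DEAL-S10-WAVE1); h413 = `stmt-HodgeConjecture-24833`, route `HCCMUnconditional`.
-/
import Summits.HodgeConjecture.HodgeConjecture.Theorems.R90S10FrozenDatumDefs                          -- ★ C2: `S10HDatum`, `S10Frozen`, `MatchE1`, `xiReduce`, carriers
import Summits.HodgeConjecture.HodgeConjecture.Theorems.R90S10FrozenVectorKit                            -- this seat's KIT: reductions, Tate-normalised Haar, frozen pure tensors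
import Summits.HodgeConjecture.HodgeConjecture.Theorems.R90S10IsUnramifiedInOfPlacesOver                 -- ★ p862583 ⟪U⟫ ⇒ `Algebra.IsUnramifiedIn`
import Summits.HodgeConjecture.HodgeConjecture.Theorems.K2E4WeakMatrixAlmostEverywhereAgreementUnitTransfer -- ★ `isMulRightInvariant_endoscopicLocal` (`H_w` unimodular)
import Summits.HodgeConjecture.HodgeConjecture.Theorems.F0P3cStCharTSCharField                           -- ★ `qsForm_map_cmConjRingHom_transpose`, `det_qsForm_ne_zero`
import Literature.NumberTheory.Rogawski1990.UnitFundamentalLemmaExplicitNonsplitClosedProof              -- ★ `isLocalUnitTransfer_of_nonsplit_of_isUnit_two` (Flicker THM 15∕18)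
import Literature.NumberTheory.Rogawski1990.UnitFundamentalLemmaSplitPlaceIdentity                       -- ★ `isLocalUnitTransfer_finExplicitCollection_of_split`
import Literature.NumberTheory.Automorphic.OrbitalMeasureCanonicalExistsCM                              -- ★ `exists_isCanonical_cmDatum_local`, `exists_isCanonical_H_local`
import Literature.NumberTheory.Automorphic.LocalUnitaryGroupUnimodularIsotropic                         -- ★ `isMulRightInvariant_cmDatum_local_antidiagOne` (`U(Φ₃)_w` unimodular)
import Literature.NumberTheory.GaloisRepresentations.HeckeCharacterConjugateDualOfQuadraticCM           -- ★ `galConj_eq_inv_of_restrict_eq_quadraticHeckeCharCM` (`hdual`)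
import HarnessLib

/-!
# R90-TF ∕ S10 — PAYER OF SOCKET A2c `sock_S10_frozenVectors`: THE FROZEN VECTOR `S10Frozen 𝔥` EXISTS, modulo the unit fundamental lemma at the
# dyadic non-split places (`hFL₂`, junction J-A2c-2) and the continuity of the `θ_∞`-reduction (`hredi`)
# (`Theorems/R90S10FrozenOfUnitTransfer.lean`; ns `Summit.HodgeConjecture.HodgeConjecture.R90.S10`; L9: ★ Theorems ∕ Literature imports only, NO `Cruxes/…/Lines` import)

SOCKET (FILE A `Cruxes/H413/Lines/R90_S10_SimpleTF1383A.lean` :263–:293, typ3; BUILT K29): under ⟪P⟫ ⟪U⟫ `h3` ⟪I⟫,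
`∀ 𝔥 : S10HDatum L μ v νHv νQv mHv mQv πSt, Nonempty (S10Frozen L μ v νHv νQv mHv mQv πSt 𝔥)` — the frozen test vector of (13.8.3) and its
`H`-transfer [Rogawski1990, §13.8 Prop. 13.8.3 (proof) p. 218 L20–L28, p. 219 L2; §4.9 Prop. 4.9.1 (b) p. 55].

## WHAT THIS FILE PROVES (road (β-FL) of record, DEAL #2 (D) + DEAL-S10-WAVE1 card p03; AUDIT N14)
`frozen_of_unitTransfer` — the socket's statement TOKEN FOR TOKEN with TWO NAMED INPUTS inserted after ⟪I⟫ and before `∀ 𝔥` (so the tail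
`∀ 𝔥, Nonempty (S10Frozen … 𝔥)` is the socket's, verbatim):
* `hFL₂` — THE UNIT FUNDAMENTAL LEMMA AT THE DYADIC NON-SPLIT PLACES `w ≠ v` [Rogawski1990, §4.9 Prop. 4.9.1 (b) p. 55 ⇐ BlasiusRogawski1992 Thm. 1]:
  for `W ∣ w` with `c • W = W` and `2 ∉ 𝒪_W^×`, every pair of canonical families for Haar measures giving the standard levels mass one satisfies
  ★ `IsLocalUnitTransfer L Φ₃ w Δ‴_w mH mG` (Borel σ-algebras).  The tree's in-house inert proof ★ `isLocalUnitTransfer_of_nonsplit_of_isUnit_two`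
  [Flicker1998UnitaryFL THM 15∕18] carries Flicker's standing `p ≠ 2`; print has no residue-characteristic guard (RULING J-A2c-2: (i) to-build leaf at
  `p = 2` ∕ (ii) ⟪U⟫″ split-dyadic) — so this is the ONE residual input of the road.  Everywhere else `htrf` is DISCHARGED here: split `w` by ★
  `isLocalUnitTransfer_finExplicitCollection_of_split`, non-split `w` with `2 ∈ 𝒪_W^×` by ★ `isLocalUnitTransfer_of_nonsplit_of_isUnit_two`
  (⟪U⟫ ⇒ `Algebra.IsUnramifiedIn` by ★ `isUnramifiedIn_of_forall_placesOver`, `μ` unramified at `W` from ⟪U⟫, `μᶜ = μ⁻¹` by ★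
  `galConj_eq_inv_of_restrict_eq_quadraticHeckeCharCM`, `Φ₃` hermitian with unit determinant and hyperspecial everywhere by ★
  `qsForm_map_cmConjRingHom_transpose` ∕ ★ `isUnit_antidiagOne_det` ∕ ★ `unit_placeForm_antidiagOne_mem_glInt`).
* `hredi` — CONTINUITY OF THE `θ_∞`-REDUCTION `h₂ ↦ ∫_{U(Φ₁)_∞} F^H(h₂, z) θ_∞(z) dν₁,∞` of every smooth `F^H ∈ C_c(H_∞)` [Rogawski1990, §13.8 p. 219 L1–L2]:
  ★ `S10HDatum` types `χi : H1Arch L → ℂ` and `ν₁i : Measure (H1Arch L)` with NO regularity (FINDING of this seat, reported to typ4∕dealer), so the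
  continuity of the forced archimedean factor `fHi₂` of `ΦH` (field `hfHi₂`) is not derivable from `𝔥`; it IS derivable from `Continuous 𝔥.χi` +
  `IsLocallyFiniteMeasure 𝔥.ν₁i` — PROVED in the KIT as `continuous_reduce_of_continuous` (Mathlib `continuous_parametric_integral_of_continuous`), which is
  the discharge of `hredi` the moment C2's ED. 2 records print's «`θ_∞` a continuous unitary character, `dz` a Haar measure».
Every other field of ★ `S10Frozen 𝔥` is CONSTRUCTED (generic lemmas in this seat's KIT `Theorems/R90S10FrozenVectorKit.lean`):
* levels `K w := U(Φ₃)(𝒪_w)` (★ `cmLocalIntegralLevel`, compact open ★ `isCompact_isOpen_cmLocalIntegralLevel`; `hKstd` is `rfl`);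
* (B4) the finite-adelic Haar measure `νf` on `Πʳ_w [U(Φ₃)_w, K_w]` with TATE'S NORMALISATION `νf(K′ × Π_{w ≠ v} K_w) = νQv(K′)` for every compact open
  `K′ ≤ U(Φ₃)_v` — KIT `exists_sliceNormalised_haar`: the `v`-slice `K′ ↦ haar{g | g_v ∈ K′, g_w ∈ K_w (w ≠ v)}` of a Haar measure of the (locally compact)
  restricted product is left invariant (translate by ★ `RestrictedProduct.mulSingle`) and finite on compacta (★ box lemma), hence a multiple
  `c · νQv` on compacta (Mathlib `measure_isMulInvariant_eq_smul_of_isCompact_closure`, `c ≠ 0` by open-positivity); rescale by `c⁻¹`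
  [CasselsFrohlich1967, Ch. II §13 (Tate); PlatonovRapinchuk1994, §5.1];
* the archimedean block `fGi hsmG hSO htrG fHi hsmH harch htrH` = the witnesses of `𝔥.harch` (★ `HasArchOpTraceI` is `HasArchOpTrace`, `Iff.rfl`),
  `fHi₂` := the `θ_∞`-reduction (`hfHi₂` is `rfl`);
* the freezing maps `ΦG φ = f_∞ ⊗ φ ⊗ 𝟙_{K^v}`, `ΦH f^H = f^H_{∞,θ} ⊗ (f^H)_{v,θ} ⊗ 𝟙_{K_2^v}` AS MEMBERS OF `C_c` = KIT `exists_frozenPureTensor` (★ `UnitaryGroup.PureTensor.toCc`,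
  bad set `{v}`, integral levels) with the POINTWISE pins `hΦG`∕`hΦH` (the `finprod` of the unit indicators IS the indicator of the box `{∀ w ≠ v, g_w ∈ K_w}`; off `v`
  `𝔥.K₂ w` is the standard level, `𝔥.hK₂std`); the `v`-factor `(f^H)_{v,θ} = xiReduce ν₁v χv f^H` is locally constant with compact
  support for EVERY `χv`, `ν₁v` (KIT `isLocSmooth_reduce`: a locally constant compactly supported `F(h₂, z)` is UNIFORMLY locally constant in `h₂` —
  tube lemma — so the integrand FUNCTIONS agree near `h₂`); the compact support of `fHi₂` is likewise regularity-free (KIT `hasCompactSupport_reduce`);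
* the off-`v` pins: Borel σ-algebras; `νQ w`, `νHw w` := Mathlib `haarMeasure` normalised ON THE LEVEL (`haarMeasure_self` ⇒ `vol(K_w) = vol(K_{H,w}) = 1`),
  right invariant by unimodularity (★ `isMulRightInvariant_cmDatum_local_antidiagOne`, ★ `isMulRightInvariant_endoscopicLocal`); CANONICAL orbital
  families `mQ w`, `mH w` by ★ `exists_isCanonical_cmDatum_local` ∕ ★ `exists_isCanonical_H_local` [Rogawski1990, §4.3 (4.3.1) p. 43];
* `htrf w` = ★ `IsLocalUnitTransfer` at `w` after `𝔥.hKH`, `𝔥.hK₂std`, `𝔥.hK₁std` (standard levels off `v`), discharged as above.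
ONE theorem (`frozen_of_unitTransfer`); no `def`, no `instance`, no `sorry`; default heartbeats.
HONEST LABEL: a helper MODULO TWO NAMED INPUTS (`hFL₂`, `hredi`); pays no socket until ★ AND the Lines edition names it; HC_CM is proved only modulo the 7
printed citations (2 remaining named inputs: hLiu418 = `stmt-HodgeConjecture-24832`, h413 = `stmt-HodgeConjecture-24833`) until rung 0 closes; REL ≠ ★ ≠ BUILT.
-/

set_option autoImplicit false
set_option linter.dupNamespace false

noncomputable section

open scoped RestrictedProduct Matrix MatrixGroups
open Filter MeasureTheory Measure NumberField IsDedekindDomain CompactlySupported Topology Set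
open Literature.NumberTheory.Rogawski1990 Literature.NumberTheory.Automorphic Literature.NumberTheory.Automorphic.UnitaryGroup
open Literature.NumberTheory.Automorphic.UnitaryGroup.CotangentForms Literature.NumberTheory.GaloisRepresentations
open Literature.NumberTheory.Automorphic.Arthur2013.Leaves.TECR
open Summit.HodgeConjecture.HodgeConjecture.Cruxes.H413.K2E1TraceFormulaBeta
open Summit.HodgeConjecture.HodgeConjecture.Cruxes.H413.K2E1SpectralTermsDiscreteHalf
open Summit.HodgeConjecture.HodgeConjecture.Cruxes.H413.F0P3cStCharTSCharField (qsForm_map_cmConjRingHom_transpose det_qsForm_ne_zero)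
open Summit.HodgeConjecture.HodgeConjecture.Cruxes.H413.K2E4WeakMatrixAlmostEverywhereAgreement (isMulRightInvariant_endoscopicLocal)

namespace Summit.HodgeConjecture.HodgeConjecture.R90.S10

/-! ## THE PAYER: `S10Frozen 𝔥` is inhabited, modulo `hFL₂` (dyadic non-split unit FL) and `hredi` (continuity of the `θ_∞`-reduction) -/

open scoped ValuativeRel in
/-- **PAYER OF SOCKET A2c `sock_S10_frozenVectors` (road (β-FL)) — THE FROZEN TEST VECTOR AND ITS `H`-TRANSFER EXIST**, modulo two named inputs.
Under ⟪P⟫ ⟪U⟫ `h3` ⟪I⟫ (the socket's binders, token for token), GIVEN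
* `hFL₂` — the unit fundamental lemma `1_{K_{H,w}} ↔ 1_{K_w}` at every DYADIC NON-SPLIT `w ≠ v` (`W ∣ w`, `c • W = W`, `2 ∉ 𝒪_W^×`) for canonical families and
  level-normalised Haar measures, Borel σ-algebras (★ `IsLocalUnitTransfer` at ★ `finExplicitCollection`) [Rogawski1990, §4.9 Prop. 4.9.1 (b) p. 55;
  BlasiusRogawski1992, Thm. 1] — the residue of the road (β-FL) (junction J-A2c-2; the non-dyadic and split places are discharged inside by ★
  `isLocalUnitTransfer_of_nonsplit_of_isUnit_two` ∕ ★ `isLocalUnitTransfer_finExplicitCollection_of_split`), and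
* `hredi` — for every datum `𝔥` and every smooth `F^H ∈ C_c(H_∞)`, CONTINUITY of the `θ_∞`-reduction `h₂ ↦ ∫ F^H(h₂, z) χ_∞(z) dν₁,∞(z)` [Rogawski1990,
  §13.8 p. 219 L1–L2] (not derivable from ★ `S10HDatum`, which leaves `χi`, `ν₁i` unconstrained; see `continuous_reduce_of_continuous` for its discharge
  from `Continuous 𝔥.χi` + `IsLocallyFiniteMeasure 𝔥.ν₁i`),
for EVERY global `H`-datum `𝔥` the structure ★ `S10Frozen L μ v νHv νQv mHv mQv πSt 𝔥` is inhabited: levels `U(Φ₃)(𝒪_w)`, the Tate-normalised finite-adelic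
Haar measure (`exists_sliceNormalised_haar`), the archimedean pair of `𝔥.harch`, the `θ_∞`-reduction, the freezing maps as honest members of `C_c` with their
pointwise pins (★ `PureTensor.toCc`), unit-mass Haar measures and canonical orbital families off `v` (★ `exists_isCanonical_cmDatum_local` ∕ `_H_local`), and the
unit ↔ unit transfers.  The conclusion `∀ 𝔥, Nonempty (S10Frozen … 𝔥)` is the socket's tail verbatim.
[cite: Rogawski1990, §13.8 Prop. 13.8.3 (proof) p. 218 L20–L28, p. 219 L1–L2; §4.9 Prop. 4.9.1 (b) p. 55; §4.3 (4.3.1) p. 43] [cite: BlasiusRogawski1992, Thm. 1]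
[cite: Flicker1998UnitaryFL, Thm. 15 p. 95; Thm. 18 p. 97] [cite: CasselsFrohlich1967, Ch. II §13] -/
theorem frozen_of_unitTransfer :
    ∀ (L : Type) [Field L] [NumberField L] [IsCMField L] (μ : HeckeCharacter L) (ξ : OneDimAutRepH L) (v : Pl L),
      (∀ w : PlacesOver L v, IsCMField.complexConj L • w.1 = w.1) → μ.IsUnitary →
      (∀ x : Literature.NumberTheory.GaloisRepresentations.ideleGroup ↥(maximalRealSubfield L),
        μ (AdeleRing.ideleBaseChange (↥(maximalRealSubfield L)) L x) = quadraticHeckeCharCM L x) →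
      (∀ w : Pl L, w ≠ v → ∀ W : PlacesOver L w, Algebra.IsUnramifiedAt (𝓞 ↥(maximalRealSubfield L)) W.1.asIdeal ∧ μ.IsUnramifiedAt W.1) →
      (3 ≤ Module.finrank ℚ ↥(maximalRealSubfield L)) →
      ∀ [MeasurableSpace (HLoc L v)] [BorelSpace (HLoc L v)] [MeasurableSpace (Gqs L v)] [BorelSpace (Gqs L v)]
        (νHv : Measure (HLoc L v)) (νQv : Measure (Gqs L v))
        [νHv.IsHaarMeasure] [νHv.IsMulRightInvariant] [νQv.IsHaarMeasure] [νQv.IsMulRightInvariant],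
      letI : ∀ a : HLoc L v, MeasurableSpace (HLoc L v ⧸ Subgroup.centralizer ({a} : Set (HLoc L v))) := fun _ => borel _
      haveI : ∀ a : HLoc L v, BorelSpace (HLoc L v ⧸ Subgroup.centralizer ({a} : Set (HLoc L v))) := fun _ => ⟨rfl⟩
      letI : ∀ γ : Gqs L v, MeasurableSpace (Gqs L v ⧸ Subgroup.centralizer ({γ} : Set (Gqs L v))) := fun _ => borel _
      haveI : ∀ γ : Gqs L v, BorelSpace (Gqs L v ⧸ Subgroup.centralizer ({γ} : Set (Gqs L v))) := fun _ => ⟨rfl⟩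
      ∀ (mHv : OrbitalMeasureFamily (HLoc L v)) (mQv : OrbitalMeasureFamily (Gqs L v)),
        mHv.IsCanonical (IsLocalGRegular L v) νHv →
        mQv.IsCanonical (fun γ => IsRegularElt (γ.val : GL (Fin 3) (UnitaryGroup.LocalRing L v))) νQv →
        ∀ (π₁ πSt : IrrClass (HLoc L v)),
          HLengthTwoLabels L v
            (torusCharPair (conjLocal L (IsCMField.complexConj L) v) (cmLocalForm L 2 v) (cmLocalForm_eq_over L 2 v) 0
              ((torusLocalComponent L (IsCMField.complexConj L) v ξ.η).comp
                  (quotConj (conjLocal L (IsCMField.complexConj L) v) (conjLocal_conjLocal_cm L v)) *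
                halfModulusChar (UnitaryGroup.LocalRing L v))
              (torusLocalComponent L (IsCMField.complexConj L) v ξ.ψ))
            ((torusLocalComponent L (IsCMField.complexConj L) v ξ.ψ).comp (localDet (IsCMField.complexConj L) v (isUnit_antidiagOne_det L 1))) π₁ πSt →
          (∀ fH : HLoc L v → ℂ, IsLocSmooth fH → π₁.smoothTrace νHv fH = charDist (ξ.xiLocalChar v) νHv fH) →
          ∀ [DecidableEq (Pl L)] [MeasurableSpace (G3 L).Adelic] [BorelSpace (G3 L).Adelic] [MeasurableSpace (H2 L).Adelic] [BorelSpace (H2 L).Adelic]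
            [MeasurableSpace (GArch L)] [BorelSpace (GArch L)] [MeasurableSpace (HArch L)] [BorelSpace (HArch L)]
            [MeasurableSpace (H1Loc L v)] [BorelSpace (H1Loc L v)] [MeasurableSpace (H1Arch L)] [BorelSpace (H1Arch L)]
            [MeasurableSpace (H1 L).Adelic] [BorelSpace (H1 L).Adelic],
          -- ══════ NAMED INPUT `hFL₂`: the unit fundamental lemma at the dyadic non-split places `w ≠ v` (junction J-A2c-2) ══════
          (∀ w : Pl L, w ≠ v → ∀ W : PlacesOver L w, IsCMField.complexConj L • W.1 = W.1 → ¬ IsUnit (2 : 𝒪[W.1.adicCompletion L]) →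
            ∀ [MeasurableSpace (HLoc L w)] [BorelSpace (HLoc L w)] [MeasurableSpace (Gqs L w)] [BorelSpace (Gqs L w)]
              [∀ a : HLoc L w, MeasurableSpace (HLoc L w ⧸ Subgroup.centralizer ({a} : Set (HLoc L w)))]
              [∀ a : HLoc L w, BorelSpace (HLoc L w ⧸ Subgroup.centralizer ({a} : Set (HLoc L w)))]
              [∀ γ : Gqs L w, MeasurableSpace (Gqs L w ⧸ Subgroup.centralizer ({γ} : Set (Gqs L w)))]
              [∀ γ : Gqs L w, BorelSpace (Gqs L w ⧸ Subgroup.centralizer ({γ} : Set (Gqs L w)))]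
              (νH : Measure (HLoc L w)) (νG : Measure (Gqs L w))
              [νH.IsHaarMeasure] [νH.IsMulRightInvariant] [νG.IsHaarMeasure] [νG.IsMulRightInvariant],
              νH (((cmLocalIntegralLevel L 2 (Matrix.of fun i j : Fin 2 => if i.val + j.val + 1 = 2 then (1 : L) else 0) w).prod
                    (cmLocalIntegralLevel L 1 (Matrix.of fun i j : Fin 1 => if i.val + j.val + 1 = 1 then (1 : L) else 0) w) :
                  Subgroup (HLoc L w)) : Set (HLoc L w)) = 1 →
              νG (cmLocalIntegralLevel L 3 (qsForm L) w : Set (Gqs L w)) = 1 →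
              ∀ (mH : OrbitalMeasureFamily (HLoc L w)) (mG : OrbitalMeasureFamily (Gqs L w)),
                mH.IsCanonical (IsLocalGRegular L w) νH →
                mG.IsCanonical (fun γ => IsRegularElt (γ.val : GL (Fin 3) (UnitaryGroup.LocalRing L w))) νG →
                IsLocalUnitTransfer L (qsForm L) w ((finExplicitCollection L (qsForm L) μ (finExplicitDelta_conj_left_all L (qsForm L) μ)
                  (finExplicitDelta_conj_right_all L (qsForm L) μ)) w) mH mG) →
          -- ══════ NAMED INPUT `hredi`: continuity of the `θ_∞`-reduction of smooth archimedean test functions ══════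
          (∀ (𝔥 : S10HDatum L μ v νHv νQv mHv mQv πSt) (FH : C_c(HArch L, ℂ)), ArchSmooth₂ L ⇑FH →
            Continuous fun h₂ : H2Arch L => ∫ z, FH (h₂, z) * 𝔥.χi z ∂𝔥.ν₁i) →
          ∀ 𝔥 : S10HDatum L μ v νHv νQv mHv mQv πSt, Nonempty (S10Frozen L μ v νHv νQv mHv mQv πSt 𝔥) := by
  intro L _ _ _ μ ξ v hv hμu hμq hunr h3 _ _ _ _ νHv νQv _ _ _ _ mHv mQv hmH hmQ π₁ πSt hlab hπ₁ _ _ _ _ _ _ _ _ _ _ _ _ _ _ _ hFL₂ hredi 𝔥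
  classical
  -- re-install the letter's quotient σ-algebras at `v` as local instances (definitionally the `letI`s of the statement)
  letI : ∀ a : HLoc L v, MeasurableSpace (HLoc L v ⧸ Subgroup.centralizer ({a} : Set (HLoc L v))) := fun _ => borel _
  haveI : ∀ a : HLoc L v, BorelSpace (HLoc L v ⧸ Subgroup.centralizer ({a} : Set (HLoc L v))) := fun _ => ⟨rfl⟩
  letI : ∀ γ : Gqs L v, MeasurableSpace (Gqs L v ⧸ Subgroup.centralizer ({γ} : Set (Gqs L v))) := fun _ => borel _
  haveI : ∀ γ : Gqs L v, BorelSpace (Gqs L v ⧸ Subgroup.centralizer ({γ} : Set (Gqs L v))) := fun _ => ⟨rfl⟩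
  -- ═════ (0) the frame: `Φ₃` hermitian, invertible, hyperspecial; `μ` conjugate self-dual ═════
  have hH' : ((qsForm L).map (IsCMField.complexConj L))ᵀ = qsForm L := qsForm_map_cmConjRingHom_transpose L
  have hH'd : IsUnit (qsForm L).det := (det_qsForm_ne_zero L).isUnit
  have hH'u : IsUnit (qsForm L) := (Matrix.isUnit_iff_isUnit_det _).2 hH'd
  have hdual : HeckeCharacter.galConj (IsCMField.complexConj L) μ = μ⁻¹ :=
    HeckeCharacter.galConj_eq_inv_of_restrict_eq_quadraticHeckeCharCM L μ hμq
  -- ═════ (1) the archimedean pair of `𝔥.harch` ═════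
  obtain ⟨fG, fH, hsmG, hsmH, htr, hSO, hop, hsign⟩ := 𝔥.harch
  -- ═════ (2) the levels `K_w = U(Φ₃)(𝒪_w)` ═════
  have hKo : ∀ w : Pl L, IsOpen (cmLocalIntegralLevel L 3 (qsForm L) w : Set (Gqs L w)) :=
    fun w => (isCompact_isOpen_cmLocalIntegralLevel L 3 (qsForm L) w).2
  have hKc : ∀ w : Pl L, IsCompact (cmLocalIntegralLevel L 3 (qsForm L) w : Set (Gqs L w)) :=
    fun w => (isCompact_isOpen_cmLocalIntegralLevel L 3 (qsForm L) w).1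
  haveI hKoF : Fact (∀ w : Pl L, IsOpen (cmLocalIntegralLevel L 3 (qsForm L) w : Set (Gqs L w))) := ⟨hKo⟩
  have hKHo : ∀ w : Pl L, IsOpen (𝔥.KH w : Set (HLoc L w)) := 𝔥.hKHo.out
  -- ═════ (3) (B4) the Tate-normalised finite-adelic Haar measure ═════
  letI msF : MeasurableSpace (Πʳ w : Pl L, [Gqs L w, cmLocalIntegralLevel L 3 (qsForm L) w]) := borel _
  haveI bsF : BorelSpace (Πʳ w : Pl L, [Gqs L w, cmLocalIntegralLevel L 3 (qsForm L) w]) := ⟨rfl⟩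
  obtain ⟨νf, hνfl, hνfc, hνf⟩ := exists_sliceNormalised_haar (fun w : Pl L => cmLocalIntegralLevel L 3 (qsForm L) w) hKc v νQv
  -- ═════ (4) off `v`: Borel σ-algebras, level-normalised Haar measures, canonical orbital families ═════
  letI msG : ∀ w : {w : Pl L // w ≠ v}, MeasurableSpace (Gqs L w.1) := fun _ => borel _
  haveI bsG : ∀ w : {w : Pl L // w ≠ v}, BorelSpace (Gqs L w.1) := fun _ => ⟨rfl⟩
  letI msH : ∀ w : {w : Pl L // w ≠ v}, MeasurableSpace (HLoc L w.1) := fun _ => borel _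
  haveI bsH : ∀ w : {w : Pl L // w ≠ v}, BorelSpace (HLoc L w.1) := fun _ => ⟨rfl⟩
  letI qQ : ∀ (w : {w : Pl L // w ≠ v}) (γ : Gqs L w.1), MeasurableSpace (Gqs L w.1 ⧸ Subgroup.centralizer ({γ} : Set (Gqs L w.1))) :=
    fun _ _ => borel _
  haveI bqQ : ∀ (w : {w : Pl L // w ≠ v}) (γ : Gqs L w.1), BorelSpace (Gqs L w.1 ⧸ Subgroup.centralizer ({γ} : Set (Gqs L w.1))) :=
    fun _ _ => ⟨rfl⟩
  letI qH : ∀ (w : {w : Pl L // w ≠ v}) (a : HLoc L w.1), MeasurableSpace (HLoc L w.1 ⧸ Subgroup.centralizer ({a} : Set (HLoc L w.1))) :=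
    fun _ _ => borel _
  haveI bqH : ∀ (w : {w : Pl L // w ≠ v}) (a : HLoc L w.1), BorelSpace (HLoc L w.1 ⧸ Subgroup.centralizer ({a} : Set (HLoc L w.1))) :=
    fun _ _ => ⟨rfl⟩
  let νQ : ∀ w : {w : Pl L // w ≠ v}, Measure (Gqs L w.1) := fun w =>
    Measure.haarMeasure (⟨⟨(cmLocalIntegralLevel L 3 (qsForm L) w.1 : Set (Gqs L w.1)), hKc w.1⟩,
      ⟨1, (by rw [(hKo w.1).interior_eq]; exact one_mem _)⟩⟩ : TopologicalSpace.PositiveCompacts (Gqs L w.1))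
  haveI hνQ : ∀ w : {w : Pl L // w ≠ v}, (νQ w).IsHaarMeasure := fun w => isHaarMeasure_haarMeasure _
  haveI hνQr : ∀ w : {w : Pl L // w ≠ v}, (νQ w).IsMulRightInvariant := fun w =>
    isMulRightInvariant_cmDatum_local_antidiagOne L 3 w.1 (νQ w)
  have hνQK : ∀ w : {w : Pl L // w ≠ v}, νQ w (cmLocalIntegralLevel L 3 (qsForm L) w.1 : Set (Gqs L w.1)) = 1 := fun w =>
    haarMeasure_self
  let νHw : ∀ w : {w : Pl L // w ≠ v}, Measure (HLoc L w.1) := fun w =>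
    Measure.haarMeasure (⟨⟨(𝔥.KH w.1 : Set (HLoc L w.1)), 𝔥.hKHc w.1⟩,
      ⟨1, (by rw [(hKHo w.1).interior_eq]; exact one_mem _)⟩⟩ : TopologicalSpace.PositiveCompacts (HLoc L w.1))
  haveI hνHw : ∀ w : {w : Pl L // w ≠ v}, (νHw w).IsHaarMeasure := fun w => isHaarMeasure_haarMeasure _
  haveI hνHwr : ∀ w : {w : Pl L // w ≠ v}, (νHw w).IsMulRightInvariant := fun w =>
    isMulRightInvariant_endoscopicLocal L w.1 (νHw w)
  have hνHK : ∀ w : {w : Pl L // w ≠ v}, νHw w (𝔥.KH w.1 : Set (HLoc L w.1)) = 1 := fun w => haarMeasure_self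
  have hmQex : ∀ w : {w : Pl L // w ≠ v}, ∃ mG : OrbitalMeasureFamily (Gqs L w.1),
      mG.IsCanonical (fun γ => IsRegularElt (γ.val : GL (Fin 3) (UnitaryGroup.LocalRing L w.1))) (νQ w) := fun w =>
    exists_isCanonical_cmDatum_local L (qsForm L) hH' hH'd w.1 (νQ w)
  choose mQ hmQ using hmQex
  have hmHex : ∀ w : {w : Pl L // w ≠ v}, ∃ mH : OrbitalMeasureFamily (HLoc L w.1), mH.IsCanonical (IsLocalGRegular L w.1) (νHw w) :=
    fun w => exists_isCanonical_H_local L w.1 (νHw w)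
  choose mH hmH using hmHex
  -- ═════ (5) the freezing map on `G`: `φ ↦ f_∞ ⊗ φ ⊗ 𝟙_{K^v}` as an honest member of `C_c` (KIT `exists_frozenPureTensor`), pinned pointwise ═════
  have hexG : ∀ φ : Gqs L v → ℂ, IsLocSmooth φ → ∃ Φ : C_c((G3 L).Adelic, ℂ), ∀ g : (G3 L).Adelic,
      Φ g = fG (UnitaryGroup.archPart (↥(maximalRealSubfield L)) L (IsCMField.complexConj L) 3 (qsForm L) g) *
        (φ ((G3 L).toLocal v g) * ∏ᶠ w : {w : Pl L // w ≠ v},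
          Set.indicator (cmLocalIntegralLevel L 3 (qsForm L) w.1 : Set (Gqs L w.1)) (fun _ => (1 : ℂ)) ((G3 L).toLocal w.1 g)) :=
    fun φ hφ => exists_frozenPureTensor L 3 (qsForm L) v (⇑fG) fG.continuous fG.hasCompactSupport φ hφ
  let ΦG : (Gqs L v → ℂ) → C_c((G3 L).Adelic, ℂ) := fun φ => if hφ : IsLocSmooth φ then Classical.choose (hexG φ hφ) else 0
  have hΦG : ∀ φ : Gqs L v → ℂ, IsLocSmooth φ → ∀ g : (G3 L).Adelic,
      ΦG φ g = fG (UnitaryGroup.archPart (↥(maximalRealSubfield L)) L (IsCMField.complexConj L) 3 (qsForm L) g) *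
        (φ ((G3 L).toLocal v g) * ∏ᶠ w : {w : Pl L // w ≠ v},
          Set.indicator (cmLocalIntegralLevel L 3 (qsForm L) w.1 : Set (Gqs L w.1)) (fun _ => (1 : ℂ)) ((G3 L).toLocal w.1 g)) := by
    intro φ hφ g
    have hΦ : ΦG φ = Classical.choose (hexG φ hφ) := dif_pos hφ
    rw [hΦ]
    exact Classical.choose_spec (hexG φ hφ) g
  -- ═════ (6) the freezing map on `H`: `f^H ↦ f^H_{∞,θ} ⊗ (f^H)_{v,θ} ⊗ 𝟙_{K_2^v}` (arch factor = the `θ_∞`-reduction, `v`-factor = ★ `xiReduce`) ═════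
  have hfHi₂c : Continuous fun h₂ : H2Arch L => ∫ z, fH (h₂, z) * 𝔥.χi z ∂𝔥.ν₁i := hredi 𝔥 fH hsmH
  have hfHi₂s : HasCompactSupport fun h₂ : H2Arch L => ∫ z, fH (h₂, z) * 𝔥.χi z ∂𝔥.ν₁i :=
    hasCompactSupport_reduce (X := H2Arch L) (Y := H1Arch L) fH.hasCompactSupport 𝔥.χi 𝔥.ν₁i
  have hred : ∀ fH' : HLoc L v → ℂ, IsLocSmooth fH' → IsLocSmooth (xiReduce 𝔥.ν₁v 𝔥.χv fH') := fun fH' hfH' =>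
    isLocSmooth_reduce (X := H2Loc L v) (Y := H1Loc L v) hfH' 𝔥.χv 𝔥.ν₁v
  have hexH : ∀ fH' : HLoc L v → ℂ, IsLocSmooth fH' → ∃ Φ : C_c((H2 L).Adelic, ℂ), ∀ h : (H2 L).Adelic,
      Φ h = (fun h₂ : H2Arch L => ∫ z, fH (h₂, z) * 𝔥.χi z ∂𝔥.ν₁i)
          (UnitaryGroup.archPart (↥(maximalRealSubfield L)) L (IsCMField.complexConj L) 2
            (Matrix.of fun i j : Fin 2 => if i.val + j.val + 1 = 2 then (1 : L) else 0) h) *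
        (xiReduce 𝔥.ν₁v 𝔥.χv fH' ((H2 L).toLocal v h) * ∏ᶠ w : {w : Pl L // w ≠ v},
          Set.indicator (cmLocalIntegralLevel L 2 (Matrix.of fun i j : Fin 2 => if i.val + j.val + 1 = 2 then (1 : L) else 0) w.1 :
            Set (H2Loc L w.1)) (fun _ => (1 : ℂ)) ((H2 L).toLocal w.1 h)) :=
    fun fH' hfH' => exists_frozenPureTensor L 2 (Matrix.of fun i j : Fin 2 => if i.val + j.val + 1 = 2 then (1 : L) else 0) v
      (fun h₂ : H2Arch L => ∫ z, fH (h₂, z) * 𝔥.χi z ∂𝔥.ν₁i) hfHi₂c hfHi₂s (xiReduce 𝔥.ν₁v 𝔥.χv fH') (hred fH' hfH')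
  let ΦH : (HLoc L v → ℂ) → C_c((H2 L).Adelic, ℂ) := fun fH' => if hfH' : IsLocSmooth fH' then Classical.choose (hexH fH' hfH') else 0
  have hΦH : ∀ fH' : HLoc L v → ℂ, IsLocSmooth fH' → ∀ h : (H2 L).Adelic,
      ΦH fH' h = (fun h₂ : H2Arch L => ∫ z, fH (h₂, z) * 𝔥.χi z ∂𝔥.ν₁i)
          (UnitaryGroup.archPart (↥(maximalRealSubfield L)) L (IsCMField.complexConj L) 2
            (Matrix.of fun i j : Fin 2 => if i.val + j.val + 1 = 2 then (1 : L) else 0) h) *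
        (xiReduce 𝔥.ν₁v 𝔥.χv fH' ((H2 L).toLocal v h) *
          ∏ᶠ w : {w : Pl L // w ≠ v}, Set.indicator (𝔥.K₂ w.1 : Set (H2Loc L w.1)) (fun _ => (1 : ℂ)) ((H2 L).toLocal w.1 h)) := by
    intro fH' hfH' h
    have hΦ : ΦH fH' = Classical.choose (hexH fH' hfH') := dif_pos hfH'
    have hfp : (∏ᶠ w : {w : Pl L // w ≠ v}, Set.indicator (𝔥.K₂ w.1 : Set (H2Loc L w.1)) (fun _ => (1 : ℂ)) ((H2 L).toLocal w.1 h)) =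
        ∏ᶠ w : {w : Pl L // w ≠ v}, Set.indicator (cmLocalIntegralLevel L 2
          (Matrix.of fun i j : Fin 2 => if i.val + j.val + 1 = 2 then (1 : L) else 0) w.1 : Set (H2Loc L w.1)) (fun _ => (1 : ℂ)) ((H2 L).toLocal w.1 h) :=
      finprod_congr fun w => by rw [𝔥.hK₂std w.1 w.2]
    rw [hfp, hΦ]
    exact Classical.choose_spec (hexH fH' hfH') h
  -- ═════ (7) the unit ↔ unit transfers off `v` (★ split ∕ ★ non-split with `2 ∈ 𝒪_W^×` ∕ `hFL₂`) ═════
  have htrf : ∀ w : {w : Pl L // w ≠ v}, IsLocalDeltaTransfer L (qsForm L) w.1 ((finExplicitCollection L (qsForm L) μ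
      (finExplicitDelta_conj_left_all L (qsForm L) μ) (finExplicitDelta_conj_right_all L (qsForm L) μ)) w.1) (mH w) (mQ w)
      (Set.indicator (𝔥.KH w.1 : Set (HLoc L w.1)) (fun _ => (1 : ℂ)))
      (Set.indicator (cmLocalIntegralLevel L 3 (qsForm L) w.1 : Set (Gqs L w.1)) (fun _ => (1 : ℂ))) := by
    intro w
    have hKHstd : 𝔥.KH w.1 = (cmLocalIntegralLevel L 2 (Matrix.of fun i j : Fin 2 => if i.val + j.val + 1 = 2 then (1 : L) else 0) w.1).prod
        (cmLocalIntegralLevel L 1 (Matrix.of fun i j : Fin 1 => if i.val + j.val + 1 = 1 then (1 : L) else 0) w.1) := by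
      rw [𝔥.hKH w.1, 𝔥.hK₂std w.1 w.2, 𝔥.hK₁std w.1 w.2]
    have hνHKstd : νHw w (((cmLocalIntegralLevel L 2 (Matrix.of fun i j : Fin 2 => if i.val + j.val + 1 = 2 then (1 : L) else 0) w.1).prod
        (cmLocalIntegralLevel L 1 (Matrix.of fun i j : Fin 1 => if i.val + j.val + 1 = 1 then (1 : L) else 0) w.1) : Subgroup (HLoc L w.1)) :
          Set (HLoc L w.1)) = 1 := by
      rw [← hKHstd]; exact hνHK w
    rw [hKHstd]
    change IsLocalUnitTransfer L (qsForm L) w.1 _ (mH w) (mQ w)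
    obtain ⟨W⟩ := UnitaryGroup.PlacesOver.nonempty L w.1
    have hunrW := hunr w.1 w.2 W
    by_cases hW : IsCMField.complexConj L • W.1 = W.1
    · by_cases h2 : IsUnit (2 : 𝒪[W.1.adicCompletion L])
      · exact isLocalUnitTransfer_of_nonsplit_of_isUnit_two L (qsForm L) hH' W hW
          (isUnramifiedIn_of_forall_placesOver L w.1 fun W' => (hunr w.1 w.2 W').1)
          (isUnit_placeForm_antidiagOne 3 W.1) (unit_placeForm_antidiagOne_mem_glInt 3 W.1) μ hunrW.2
          (νHw w) (νQ w) (hmH w) (hmQ w) hνHKstd (hνQK w)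
          (finExplicitDelta_conj_left_all L (qsForm L) μ) (finExplicitDelta_conj_right_all L (qsForm L) μ) hH'u hμu hμq h2
      · exact hFL₂ w.1 w.2 W hW h2 (νHw w) (νQ w) hνHKstd (hνQK w) (mH w) (mQ w) (hmH w) (hmQ w)
    · exact isLocalUnitTransfer_finExplicitCollection_of_split L (qsForm L) W hW hH' hH'u (unit_placeForm_antidiagOne_mem_glInt 3 W.1) μ hdual hunrW.2
        (νQ w) (hνQK w) (νHw w) hνHKstd (mH w) (mQ w) (hmH w) (hmQ w)
        (finExplicitDelta_conj_left_all L (qsForm L) μ) (finExplicitDelta_conj_right_all L (qsForm L) μ)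
  -- ═════ (8) assembly ═════
  exact ⟨{ K := fun w => cmLocalIntegralLevel L 3 (qsForm L) w
           hKo := ⟨hKo⟩
           hKc := hKc
           hKstd := fun _ _ => rfl
           msF := msF
           bsF := bsF
           νf := νf
           hνfl := hνfl
           hνfc := hνfc
           hνf := hνf
           fGi := fG
           hsmG := hsmG
           hSO := hSO
           htrG := hsign
           fHi := fH
           hsmH := hsmH
           harch := htr
           htrH := hop
           fHi₂ := fun h₂ => ∫ z, fH (h₂, z) * 𝔥.χi z ∂𝔥.ν₁i
           hfHi₂ := fun _ => rfl
           ΦG := ΦG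
           hΦG := hΦG
           ΦH := ΦH
           hΦH := hΦH
           msG := msG
           bsG := bsG
           νQ := νQ
           hνQ := hνQ
           hνQr := hνQr
           hνQK := fun w => by rw [measureReal_def, hνQK w, ENNReal.toReal_one]
           qQ := qQ
           bqQ := bqQ
           mQ := mQ
           hmQ := hmQ
           msH := msH
           bsH := bsH
           νHw := νHw
           hνHw := hνHw
           hνHwr := hνHwr
           hνHK := fun w => by rw [measureReal_def, hνHK w, ENNReal.toReal_one]
           qH := qH
           bqH := bqH
           mH := mH
           hmH := hmH
           htrf := htrf }⟩

end Summit.HodgeConjecture.HodgeConjecture.R90.S10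

end
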